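import Literature.NumberTheory.EllipticCurves.ShintaniGenusSymmetry
import Literature.NumberTheory.EllipticCurves.ShintaniConeGaussSums
import HarnessLib

/-!
# The genus weight for `D ≡ 3 (mod 4)`: the generic character of the odd discriminant `-D`

[[cite: Shintani1975, §2 (2.1), Thm. 2 (characters `χ` on `L/NL`)]] and Gross–Kohnen–Zagier II,
§I.1–I.2 (the generic characters `χ_D(Q)`) — the tree's twisted Shintani kernels
`K_D = (Im z)^{1/2} ∑_v ω_D(v) f_{w, z/(256D)}(ι v)` (`ShintaniKernelPoisson.kerD`) carry the weight
`ω_D(v) = χ₋₄(v₂) ∏_{p ∣ D} Ω_p(v)` (`ShintaniGenusSymbols.genusWt`), the generic character of the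
EVEN discriminant `-4D`; it is odd in `v` exactly when `D ≡ 1 (mod 4)`, and `K_D ≡ 0` for
`D ≡ 3 (mod 4)` (`kerD_eq_zero_of_mod_four`).  The class `D ≡ 3 (mod 8)` of
`Literature.NumberTheory.EllipticCurves.Tunnell1983_a_sq_propto_L_one` (Tunnell's `a(n)`,
`n ≡ 3 (mod 8)`; `L(E_D, 1) = L(φ ⊗ (·/D), 1)`) therefore needs the OTHER genus weight, that of
the odd fundamental discriminant `-D`: **`genusWtOdd D v = ∏_{p ∣ D} Ω_p(v)`** (no `2`-adic factor;
`ω_D = χ₋₄(v₂) · ω⁻_D`, `genusWt_eq_χ₄_mul_genusWtOdd`).  PROVED: `|ω⁻_D| ≤ 1`, `ω⁻_D(v) = 0`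
unless `D ∣ n(v)`, periodicity modulo any `M` with `D ∣ M` (`genusWtOdd_congr`, no condition at
`2`), the parity `ω⁻_D(-v) = χ₄(D) ω⁻_D(v)` — **odd for `D ≡ 3 (mod 4)`**
(`genusWtOdd_neg_of_mod_four_eq_three`), even for `D ≡ 1 (mod 4)` —, `Γ₀(64)`-invariance
(`genusWtOdd_actInt`), the scaling `ω⁻_D(tv) = (t/D) ω⁻_D(v)` and the **symmetry
`ω⁻_D(v) = ω⁻_{D'}(v)` on `n(v) = DD'`, `D ≡ D' (mod 4)`** (`genusWtOdd_eq_of_nQ_eq_mul`, from the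
tree's `prod_coneSym_eq_of_nQ_eq_mul`; `v₂` is automatically odd since `n(v) = 64v₁² - v₀v₂` is
odd).  The kernel built on `ω⁻_D` and its level law are the sequel.

No named facts; the only definition is `genusWtOdd`.
-/

noncomputable section

open Complex Real

namespace Literature.NumberTheory.EllipticCurves.Shintani

/-! ### The weight `ω⁻_D = ∏_{p ∣ D} Ω_p` -/

/-- **The genus weight of the odd discriminant `-D`**: `ω⁻_D(v) = ∏_{p ∣ D} Ω_p(v)` (`D` odd
square-free), the product of the local genus symbols WITHOUT the `2`-adic character `χ₋₄(v₂)`.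
[cite: Shintani1975, §2, Thm. 2 (characters `χ` on `L/NL`)] -/
def genusWtOdd (D : ℕ) (v : Fin 3 → ℤ) : ℤ := ∏ p ∈ D.primeFactors, coneSym p v

/-- `ω_D(v) = χ₋₄(v₂) ω⁻_D(v)`. [folklore] -/
theorem genusWt_eq_χ₄_mul_genusWtOdd (D : ℕ) (v : Fin 3 → ℤ) :
    genusWt D v = ZMod.χ₄ (v 2) * genusWtOdd D v := rfl

/-- `|ω⁻_D(v)| ≤ 1`. [folklore] -/
theorem abs_genusWtOdd_le (D : ℕ) (v : Fin 3 → ℤ) : |genusWtOdd D v| ≤ 1 := by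
  unfold genusWtOdd
  rw [Finset.abs_prod]
  exact Finset.prod_le_one (fun _ _ ↦ abs_nonneg _) (fun p _ ↦ abs_coneSym_le p v)

/-- `ω⁻_D(v) = 0` unless `D ∣ n(v)` (`D` square-free). [folklore] -/
theorem genusWtOdd_of_not_dvd {D : ℕ} (hD : Squarefree D) {v : Fin 3 → ℤ} (h : ¬ (D : ℤ) ∣ nQ v) :
    genusWtOdd D v = 0 := by
  unfold genusWtOdd
  by_contra hne
  apply h
  apply natCast_dvd_of_primeFactors_dvd hD
  intro p hp
  by_contra hpn
  exact hne (Finset.prod_eq_zero hp (coneSym_of_not_dvd hpn))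

/-- **Periodicity**: `ω⁻_D` depends on `v` only modulo `M` whenever `D ∣ M` (no condition at `2`).
[folklore] -/
theorem genusWtOdd_congr {D : ℕ} {M : ℤ} (hDM : (D : ℤ) ∣ M) {v u : Fin 3 → ℤ}
    (h : ∀ i, v i ≡ u i [ZMOD M]) : genusWtOdd D v = genusWtOdd D u := by
  unfold genusWtOdd
  refine Finset.prod_congr rfl fun p hp ↦ coneSym_congr ?_ h
  exact dvd_trans (Int.natCast_dvd_natCast.mpr (Nat.dvd_of_mem_primeFactors hp)) hDM

/-- **Parity**: `ω⁻_D(-v) = χ₄(D) ω⁻_D(v)` (`D` odd square-free). [folklore] -/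
theorem genusWtOdd_neg {D : ℕ} (hD : Squarefree D) (hDodd : Odd D) (v : Fin 3 → ℤ) :
    genusWtOdd D (-v) = ZMod.χ₄ D * genusWtOdd D v := by
  unfold genusWtOdd
  have hodd : ∀ p ∈ D.primeFactors, Odd p := fun p hp ↦
    hDodd.of_dvd_nat (Nat.dvd_of_mem_primeFactors hp)
  rw [Finset.prod_congr rfl fun p hp ↦ coneSym_neg (hodd p hp) v, Finset.prod_mul_distrib,
    prod_χ₄_primeFactors hD]

/-- **`ω⁻_D` is ODD for `D ≡ 3 (mod 4)`** (square-free): the parity needed by the Shintani kernel of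
weight `3/2`. [folklore] -/
theorem genusWtOdd_neg_of_mod_four_eq_three {D : ℕ} (hD : Squarefree D) (h3 : D % 4 = 3)
    (v : Fin 3 → ℤ) : genusWtOdd D (-v) = -genusWtOdd D v := by
  rw [genusWtOdd_neg hD (Nat.odd_iff.mpr (by omega)) v]
  have : (ZMod.χ₄ (D : ZMod 4) : ℤ) = -1 := by
    rw [ZMod.χ₄_nat_mod_four, h3]; decide
  rw [this]; ring

/-- `ω⁻_D` is even for `D ≡ 1 (mod 4)` (square-free). [folklore] -/
theorem genusWtOdd_neg_of_mod_four_eq_one {D : ℕ} (hD : Squarefree D) (h1 : D % 4 = 1)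
    (v : Fin 3 → ℤ) : genusWtOdd D (-v) = genusWtOdd D v := by
  rw [genusWtOdd_neg hD (Nat.odd_iff.mpr (by omega)) v]
  have : (ZMod.χ₄ (D : ZMod 4) : ℤ) = 1 := by
    rw [ZMod.χ₄_nat_mod_four, h1]; decide
  rw [this]; ring

/-- **`ω⁻_D` is `Γ₀(64)`-invariant** (`D` odd). [folklore] -/
theorem genusWtOdd_actInt {D : ℕ} (hDodd : Odd D) {a b c' d : ℤ}
    (hdet : a * d - 64 * b * c' = 1) (v : Fin 3 → ℤ) :
    genusWtOdd D (actInt a b c' d v) = genusWtOdd D v := by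
  unfold genusWtOdd
  refine Finset.prod_congr rfl fun p hp ↦ ?_
  have hpp := Nat.prime_of_mem_primeFactors hp
  haveI := Fact.mk hpp
  have hp2 : p ≠ 2 := by
    rintro rfl
    exact (Nat.not_even_iff_odd.mpr hDodd) (even_iff_two_dvd.mpr (Nat.dvd_of_mem_primeFactors hp))
  exact coneSym_actInt hp2 hdet v

/-- **Scaling**: `ω⁻_D(t v) = (t/D) ω⁻_D(v)` (`D` square-free). [folklore] -/
theorem genusWtOdd_smul {D : ℕ} (hD : Squarefree D) (t : ℤ) (v : Fin 3 → ℤ) :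
    genusWtOdd D (t • v) = jacobiSym t D * genusWtOdd D v := by
  unfold genusWtOdd
  rw [Finset.prod_congr rfl fun p hp ↦ coneSym_smul (Nat.prime_of_mem_primeFactors hp) t v,
    Finset.prod_mul_distrib, ← jacobiSym_eq_prod_primeFactors hD]

/-- If `n(v) = 64v₁² - v₀v₂` is odd then `v₂` is odd. [folklore] -/
theorem odd_two_of_odd_nQ {v : Fin 3 → ℤ} (h : Odd (nQ v)) : Odd (v 2) := by
  by_contra h2
  rw [Int.not_odd_iff_even] at h2
  apply Int.not_even_iff_odd.mpr h
  unfold nQ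
  exact Even.sub ⟨32 * v 1 ^ 2, by ring⟩ (h2.mul_left (v 0))

/-- **Symmetry of `ω⁻`**: for odd square-free `D ≡ D' (mod 4)` and every `v` with `n(v) = D D'`,
`ω⁻_D(v) = ω⁻_{D'}(v)` (the arithmetic heart of the symmetry `√D' c_D(D') = √D c_{D'}(D)` of the
twisted lifts, now for the odd discriminants). [cite: Shintani1975, §2, Thm. 2] -/
theorem genusWtOdd_eq_of_nQ_eq_mul {D D' : ℕ} (hD : Squarefree D) (hD' : Squarefree D')
    (hDodd : Odd D) (hD'odd : Odd D') (hmod : D % 4 = D' % 4) {v : Fin 3 → ℤ}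
    (hn : nQ v = D * D') : genusWtOdd D v = genusWtOdd D' v := by
  have hv2 : Odd (v 2) := by
    apply odd_two_of_odd_nQ
    rw [hn]
    exact_mod_cast hDodd.mul hD'odd
  exact prod_coneSym_eq_of_nQ_eq_mul hD hD' hDodd hD'odd hmod hv2 hn

end Literature.NumberTheory.EllipticCurves.Shintani
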